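/-
Copyright: b2b-lace packet (LEAN TYPING SEAT 1 gen 34, leaf BESSELJ-ORDERTAIL-GEOM).
The Bessel-`J` ORDER TAIL `Σ_{l ≥ 0} |J_{l+J+1}(y)|` in the Leibniz regime `y² ≤ 4(J+2)` bounded by a
GEOMETRIC series: every factor rational in `y` and `J`, no exponential.  Elementary; hypothesis-free;
no `sorry`; no dimension; no number.
-/
import Literature.Analysis.FunctionSpaces.BesselJAlternatingBound
import HarnessLib

/-!
# The Bessel-`J` order tail by a geometric series (exponential-free)

CITATION HEADER (PLACEMENT v2). Part of the certified REPRODUCTION of the numerical inputs of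
R. Fitzner, R. van der Hofstad, *Generalized approach to the non-backtracking lace expansion*,
Probab. Theory Related Fields 169 (2017) 1041–1119 [NoBLE17-I] (arXiv:1506.07969), §5.1.1 (5.2)–(5.5)
p. 1089–1090 (one-dimensional Bessel rows of the twisted SRW integrals and their truncation), as consumed by
*Mean-field behavior for nearest-neighbor percolation in `d > 10`*, Electron. J. Probab. 22 (2017) no. 43.
Origin: build `lace`, unit `b2b-lace-lean1-g34` (what-if / input-certification support; nothing here is a
certificate).

## What is proved, and why

Every truncation budget of a twisted Bessel row (`SrwTwistRowOrderBall`, `SrwTwistCosPowRow`,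
`SrwTwistKeptRowOrderBall`, `SrwTwistTruncationSeeds`, …) is a multiple of the ORDER TAIL
`δ_J(y) = Σ_{l ≥ 0} |J_{l+J+1}(y)|`.  The tree bounds it in closed form by the exponential MAJORANT series:
`δ_J(y) ≤ |y/2|^{J+1}/(J+1)! · e^{|y/2|² + |y/2|}` for all `y` (`tsum_abs_besselJ_tail_le`), and in the
Leibniz regime `y² ≤ 4(J+2)` by `|y/2|^{J+1}/(J+1)! · e^{|y/2|}` (`tsum_abs_besselJ_orderTail_le_of_sq_le`,
from the sharp `|J_n(y)| ≤ |y/2|ⁿ/n!`, DLMF 10.14.4, and `(J+1)!·l! ≤ (l+J+1)!`).  A kernel instance at a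
rational argument `y > 1` then needs a rational majorant of `e^{y/2}`.  Here the factorial inequality is
replaced by **`(J+1)!·(J+2)^l ≤ (l+J+1)!`**, which turns the majorant into a GEOMETRIC series of ratio
`|y/2|/(J+2)` — automatically `< 1` in the Leibniz regime (`|y/2| ≤ √(J+2) < J+2`):

* `abs_besselJ_orderTail_term_le_geom`: `|J_{l+J+1}(y)| ≤ |y/2|^{J+1}/(J+1)! · (|y/2|/(J+2))^l`;
* **`tsum_abs_besselJ_orderTail_le_geom`**: `δ_J(y) ≤ |y/2|^{J+1}/(J+1)! · (J+2)/((J+2) − |y/2|)`;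
* **`tsum_abs_besselJ_orderTail_le_two_mul`**: `δ_J(y) ≤ 2 · |y/2|^{J+1}/(J+1)!` whenever in addition
  `|y| ≤ J+2` (ratio `≤ 1/2`); `tsum_abs_besselJ_orderTail_le_two_mul_of_abs_le_two`: the same for
  `|y| ≤ 2` and EVERY `J`, with no further side condition;
* `tsum_abs_besselJ_orderTail_le_sum_add_geom`: the finite-plus-tail split
  `δ_J(y) ≤ Σ_{l<K} |J_{l+J+1}(y)| + |y/2|^{J+K+1}/(J+K+1)! · (J+K+2)/((J+K+2) − |y/2|)`
  (enclose the first `K` tail orders individually, e.g. by `BesselJLiteralCert`, bound the rest).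

All factors are RATIONAL in `y` and `J`: no `Real.exp` literal is ever needed downstream (at `y = 3`,
`J = 10` the geometric factor is `8/7`, against `e^{3/2}`).  Number-free, dimension-free, standard axioms.

## References
* [DLMF] NIST Digital Library of Mathematical Functions — 10.2.2 (series), 10.14.4 (`|J_n(x)| ≤ |x/2|ⁿ/n!`).
* [Watson1944] G. N. Watson, *A Treatise on the Theory of Bessel Functions*, 2nd ed., CUP 1944 — §2.11, §3.31.
* [NoBLE17-I] R. Fitzner, R. van der Hofstad, PTRF 169 (2017) 1041–1119; arXiv:1506.07969 — §5.1.1 (5.2)–(5.5).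
-/

noncomputable section

open Finset Filter
open scoped Nat Topology

namespace Literature.Analysis.FunctionSpaces

/-- `(J+1)!·(J+2)^l ≤ (l+J+1)!` (each of the `l` factors `J+2, …, J+l+1` of `(l+J+1)!/(J+1)!` is at
least `J+2`). [folklore] -/
private theorem factorial_mul_pow_le_factorial_add (J l : ℕ) :
    (J + 1)! * (J + 2) ^ l ≤ (l + J + 1)! := by
  induction l with
  | zero => simp
  | succ l ih =>
      rw [show l + 1 + J + 1 = (l + J + 1) + 1 by ring, Nat.factorial_succ, pow_succ, ← mul_assoc]
      calc (J + 1)! * (J + 2) ^ l * (J + 2) ≤ (l + J + 1)! * (J + 2) := Nat.mul_le_mul_right _ ih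
        _ ≤ (l + J + 1)! * (l + J + 1 + 1) := Nat.mul_le_mul_left _ (by omega)
        _ = (l + J + 1 + 1) * (l + J + 1)! := by ring

/-- In the Leibniz regime the geometric ratio is below one: `y² ≤ 4(J+2)` gives `|y/2| < J+2`
(`|y/2|² ≤ J+2 < (J+2)²`). [folklore] -/
private theorem abs_div_two_lt_of_sq_le (J : ℕ) {y : ℝ} (h : y ^ 2 ≤ 4 * (J + 2)) :
    |y / 2| < (J : ℝ) + 2 := by
  have hs : 0 ≤ |y / 2| := abs_nonneg _
  have hsq : |y / 2| ^ 2 ≤ (J : ℝ) + 2 := by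
    rw [sq_abs, div_pow]; linarith
  refine lt_of_not_ge fun hle => ?_
  have hJ : (2 : ℝ) ≤ (J : ℝ) + 2 := by
    have : (0 : ℝ) ≤ J := Nat.cast_nonneg J
    linarith
  nlinarith

/-- **Termwise geometric bound:** for `y² ≤ 4(J+2)` and every `l`,
`|J_{l+J+1}(y)| ≤ |y/2|^{J+1}/(J+1)! · (|y/2|/(J+2))^l` (sharp `|J_n| ≤ |y/2|ⁿ/n!` at `n = l+J+1` and
`(J+1)!·(J+2)^l ≤ (l+J+1)!`). [cite: DLMF, 10.14.4; Watson1944, §3.31] -/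
theorem abs_besselJ_orderTail_term_le_geom (J : ℕ) {y : ℝ} (h : y ^ 2 ≤ 4 * (J + 2)) (l : ℕ) :
    |besselJ (l + J + 1) y|
      ≤ |y / 2| ^ (J + 1) / ((J + 1)! : ℝ) * (|y / 2| / ((J : ℝ) + 2)) ^ l := by
  have hl : y ^ 2 ≤ 4 * ((l + J + 1 : ℕ) + 1 : ℝ) := by
    push_cast
    have : (0 : ℝ) ≤ l := Nat.cast_nonneg l
    linarith
  have hb := abs_besselJ_le_pow_div_factorial_of_sq_le (l + J + 1) hl
  have hs : 0 ≤ |y / 2| := abs_nonneg _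
  have hfac : ((J + 1)! : ℝ) * ((J : ℝ) + 2) ^ l ≤ ((l + J + 1)! : ℝ) := by
    exact_mod_cast factorial_mul_pow_le_factorial_add J l
  have hJpos : (0 : ℝ) < (J + 1)! := by positivity
  have hJ2 : (0 : ℝ) < ((J : ℝ) + 2) ^ l := by positivity
  calc |besselJ (l + J + 1) y| ≤ |y / 2| ^ (l + J + 1) / ((l + J + 1)! : ℝ) := hb
    _ ≤ |y / 2| ^ (l + J + 1) / (((J + 1)! : ℝ) * ((J : ℝ) + 2) ^ l) := by gcongr
    _ = |y / 2| ^ (J + 1) / ((J + 1)! : ℝ) * (|y / 2| / ((J : ℝ) + 2)) ^ l := by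
        rw [show l + J + 1 = (J + 1) + l by ring, pow_add, div_pow]
        field_simp

/-- **Order tail, geometric closed form (exponential-free):** for `y² ≤ 4(J+2)`,
`Σ_{l ≥ 0} |J_{l+J+1}(y)| ≤ |y/2|^{J+1}/(J+1)! · (J+2)/((J+2) − |y/2|)`.
[cite: DLMF, 10.14.4; Watson1944, §3.31; FitznerVanDerHofstad2016NoBLE, §5.1.1 (5.4)–(5.5)] -/
theorem tsum_abs_besselJ_orderTail_le_geom (J : ℕ) {y : ℝ} (h : y ^ 2 ≤ 4 * (J + 2)) :
    ∑' l : ℕ, |besselJ (l + J + 1) y|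
      ≤ |y / 2| ^ (J + 1) / ((J + 1)! : ℝ) * (((J : ℝ) + 2) / (((J : ℝ) + 2) - |y / 2|)) := by
  have hs : 0 ≤ |y / 2| := abs_nonneg _
  have hlt := abs_div_two_lt_of_sq_le J h
  have hJ2 : (0 : ℝ) < (J : ℝ) + 2 := by positivity
  have hr0 : 0 ≤ |y / 2| / ((J : ℝ) + 2) := div_nonneg hs hJ2.le
  have hr1 : |y / 2| / ((J : ℝ) + 2) < 1 := (div_lt_one hJ2).2 hlt
  have hgeom : HasSum (fun l : ℕ => (|y / 2| / ((J : ℝ) + 2)) ^ l) (1 - |y / 2| / ((J : ℝ) + 2))⁻¹ :=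
    hasSum_geometric_of_lt_one hr0 hr1
  have hmaj := hgeom.mul_left (|y / 2| ^ (J + 1) / ((J + 1)! : ℝ))
  have hsum : ∑' l : ℕ, |besselJ (l + J + 1) y|
      ≤ |y / 2| ^ (J + 1) / ((J + 1)! : ℝ) * (1 - |y / 2| / ((J : ℝ) + 2))⁻¹ := by
    calc ∑' l : ℕ, |besselJ (l + J + 1) y|
        ≤ ∑' l : ℕ, |y / 2| ^ (J + 1) / ((J + 1)! : ℝ) * (|y / 2| / ((J : ℝ) + 2)) ^ l :=
          (summable_abs_besselJ_orderTail_of_sq_le J h).tsum_le_tsum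
            (fun l => abs_besselJ_orderTail_term_le_geom J h l) hmaj.summable
      _ = |y / 2| ^ (J + 1) / ((J + 1)! : ℝ) * (1 - |y / 2| / ((J : ℝ) + 2))⁻¹ := hmaj.tsum_eq
  have hne : ((J : ℝ) + 2) - |y / 2| ≠ 0 := by linarith
  have heq : (1 - |y / 2| / ((J : ℝ) + 2))⁻¹ = ((J : ℝ) + 2) / (((J : ℝ) + 2) - |y / 2|) := by
    field_simp
  rw [heq] at hsum
  exact hsum

/-- **Order tail, factor two:** for `y² ≤ 4(J+2)` and `|y| ≤ J+2` (ratio `≤ 1/2`),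
`Σ_{l ≥ 0} |J_{l+J+1}(y)| ≤ 2 · |y/2|^{J+1}/(J+1)!`.
[cite: DLMF, 10.14.4; Watson1944, §3.31; FitznerVanDerHofstad2016NoBLE, §5.1.1 (5.4)–(5.5)] -/
theorem tsum_abs_besselJ_orderTail_le_two_mul (J : ℕ) {y : ℝ} (h : y ^ 2 ≤ 4 * (J + 2))
    (hy : |y| ≤ (J : ℝ) + 2) :
    ∑' l : ℕ, |besselJ (l + J + 1) y| ≤ 2 * (|y / 2| ^ (J + 1) / ((J + 1)! : ℝ)) := by
  have hs : 0 ≤ |y / 2| := abs_nonneg _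
  have hJ2 : (0 : ℝ) < (J : ℝ) + 2 := by positivity
  have hhalf : |y / 2| ≤ ((J : ℝ) + 2) / 2 := by
    rw [abs_div, abs_two]; linarith
  have hden : 0 < ((J : ℝ) + 2) - |y / 2| := by linarith
  have hfac : ((J : ℝ) + 2) / (((J : ℝ) + 2) - |y / 2|) ≤ 2 := by
    rw [div_le_iff₀ hden]; linarith
  have hC : 0 ≤ |y / 2| ^ (J + 1) / ((J + 1)! : ℝ) := by positivity
  calc ∑' l : ℕ, |besselJ (l + J + 1) y|
      ≤ |y / 2| ^ (J + 1) / ((J + 1)! : ℝ) * (((J : ℝ) + 2) / (((J : ℝ) + 2) - |y / 2|)) :=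
        tsum_abs_besselJ_orderTail_le_geom J h
    _ ≤ |y / 2| ^ (J + 1) / ((J + 1)! : ℝ) * 2 := by gcongr
    _ = 2 * (|y / 2| ^ (J + 1) / ((J + 1)! : ℝ)) := by ring

/-- **Order tail, factor two, for `|y| ≤ 2` and every `J`:** `Σ_{l ≥ 0} |J_{l+J+1}(y)| ≤ 2 · |y/2|^{J+1}/(J+1)!`
(`|y| ≤ 2` gives both `y² ≤ 4 ≤ 4(J+2)` and `|y| ≤ J+2`).
[cite: DLMF, 10.14.4; Watson1944, §3.31; FitznerVanDerHofstad2016NoBLE, §5.1.1 (5.4)–(5.5)] -/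
theorem tsum_abs_besselJ_orderTail_le_two_mul_of_abs_le_two (J : ℕ) {y : ℝ} (hy : |y| ≤ 2) :
    ∑' l : ℕ, |besselJ (l + J + 1) y| ≤ 2 * (|y / 2| ^ (J + 1) / ((J + 1)! : ℝ)) := by
  have hJ : (0 : ℝ) ≤ J := Nat.cast_nonneg J
  have hy2 : y ^ 2 ≤ 4 := by
    have h := abs_le.1 hy
    nlinarith [h.1, h.2]
  exact tsum_abs_besselJ_orderTail_le_two_mul J (by linarith) (by linarith)

/-- **Finite-plus-geometric split of the order tail:** for `y² ≤ 4(J+2)` and every `K`,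
`Σ_{l ≥ 0} |J_{l+J+1}(y)| ≤ Σ_{l<K} |J_{l+J+1}(y)| + |y/2|^{J+K+1}/(J+K+1)! · (J+K+2)/((J+K+2) − |y/2|)`
(enclose the first `K` tail orders individually, bound the rest geometrically).
[cite: DLMF, 10.14.4; Watson1944, §3.31; FitznerVanDerHofstad2016NoBLE, §5.1.1 (5.4)–(5.5)] -/
theorem tsum_abs_besselJ_orderTail_le_sum_add_geom (J K : ℕ) {y : ℝ} (h : y ^ 2 ≤ 4 * (J + 2)) :
    ∑' l : ℕ, |besselJ (l + J + 1) y|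
      ≤ ∑ l ∈ Finset.range K, |besselJ (l + J + 1) y|
        + |y / 2| ^ (J + K + 1) / ((J + K + 1)! : ℝ)
          * (((J + K : ℕ) : ℝ) + 2) / ((((J + K : ℕ) : ℝ) + 2) - |y / 2|) := by
  have hK : y ^ 2 ≤ 4 * ((J + K : ℕ) + 2 : ℝ) := by
    push_cast
    have : (0 : ℝ) ≤ K := Nat.cast_nonneg K
    linarith
  rw [tsum_abs_besselJ_orderTail_eq_sum_add_tsum J K (summable_abs_besselJ_orderTail_of_sq_le J h),
    mul_div_assoc]
  gcongr
  exact tsum_abs_besselJ_orderTail_le_geom (J + K) hK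

end Literature.Analysis.FunctionSpaces

end
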